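import Summits.NavierStokesRegularity.NavierStokesRegularity.Theorems.ScalingDefectPeepholeDoorDefs
import Literature.Analysis.FluidPDE.PineauVicolOneSlicePressure

/-!
# ScalingDefectPeepholeDoorSlicePressureDual — door S30 «ScalingDefectPeepholeDoor», plate P2 (K1ω) input hP, part 1:
# the DUAL SLICE PRESSURE ESTIMATE AT EXPONENT 2 (ns-s29-p2 g2 for ns-s30-p1 g0)

The exponent-`2` twin of the tree's dual device `Literature.Analysis.FluidPDE.PineauVicolOneSlicePressure`
(`abs_integral_mul_test_le_of_slice_identity`, exponents `3/2`–`3`): for a slice `(v, π)` with the weak slice pressure equation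
`∫ π Δψ = −∫ D²ψ(v,v)` on `B(0,R)` and `|π| ≤ C_p` on the shell, and a test function `g` supported in `B(0,r)`,

  `|∫ π g| ≤ (9 A ‖v‖²_{L⁴(B_R)} + C_p C_Λ) ‖g‖_{L²}`

(Cauchy–Schwarz instead of Hölder `3/2`–`3`, the Calderón–Zygmund bound at `p = 2`), and the duality `(L²)' = L²`:
`∫_{B(0,r)} |π|² ≤ K²`.  Part 2 (`…SlicePressureL2`) turns this into the `q = 4` slice bound
`∫_{B_{1/32}}|p(t)|² ≤ C₁ ∫_{B_{3/4}}|u(t)|⁴ + C₂(C_p)` and, with Type I, into `‖p(t)‖_{L²(B(0,R√(−t)))} ≤ C_P (−t)^{−1/4}`.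

* `lintegral_enorm_hessian_apply_le_sq` — `∫|D²Θ(v,v)| ≤ 9 ‖v‖²_{L⁴(N)} S` when the second derivatives of `Θ` have `L²` norm `≤ S`;
* `integral_abs_le_measureReal_rpow_mul_eLpNorm_two` — `‖g‖_{L¹} ≤ |B(0,r)|^{1/2} ‖g‖_{L²}`;
* `exists_abs_integral_mul_newtonFarSmoothing_le_two` — the smoothing term `|∫ π Λ[g]| ≤ C_p C ‖g‖_{L²}`;
* `abs_integral_mul_test_le_of_slice_identity_two` — the dual estimate; `lintegral_ball_enorm_sq_le_of_forall_test` — duality.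

Door S30 is a regularity CRITERION (item 0056 `NoTypeII` stays OPEN); nothing here bears on NS regularity itself.
-/

noncomputable section

set_option linter.dupNamespace false

namespace Summit.NavierStokesRegularity.NavierStokesRegularity.Theorems.ScalingDefectPeepholeDoor

open MeasureTheory Set Function Filter Metric TopologicalSpace
open scoped ENNReal NNReal InnerProductSpace RealInnerProductSpace Laplacian Topology
open Literature.Analysis Literature.Analysis.FluidPDE

/-! ## §1 The Hessian pairing at exponents `4`–`2` -/

/-- `(a²)^2 = a⁴` in `ℝ≥0∞` (real exponent `2` on the left). -/
theorem ennreal_sq_rpow_two (a : ℝ≥0∞) : (a ^ 2) ^ (2 : ℝ) = a ^ (4 : ℕ) := by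
  rw [show (2 : ℝ) = ((2 : ℕ) : ℝ) by norm_num, ENNReal.rpow_natCast, ← pow_mul]

/-- `‖f‖_{L²} = (∫ ‖f‖ₑ²)^{1/2}` with a real exponent. -/
theorem eLpNorm_two_eq' {f : EuclideanSpace ℝ (Fin 3) → ℝ} {μ : Measure (EuclideanSpace ℝ (Fin 3))} :
    eLpNorm f 2 μ = (∫⁻ x, ‖f x‖ₑ ^ (2 : ℝ) ∂μ) ^ (1 / 2 : ℝ) := by
  rw [eLpNorm_eq_lintegral_rpow_enorm_toReal two_ne_zero ENNReal.ofNat_ne_top, ENNReal.toReal_ofNat]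

/-- **The Hessian pairing `∫ |D²Θ(v, v)|` against a field in `L⁴`** (Cauchy–Schwarz): if `Θ ∈ C²` is supported in `N` and the
coordinate second derivatives of `Θ` have `L²` norm at most `S`, then `∫ |D²Θ(v, v)| ≤ 9 ‖v‖²_{L⁴(N)} S`. -/
theorem lintegral_enorm_hessian_apply_le_sq {Θ : (EuclideanSpace ℝ (Fin 3)) → ℝ} (hΘ2 : ContDiff ℝ 2 Θ)
    {N : Set (EuclideanSpace ℝ (Fin 3))} (hsupp : tsupport Θ ⊆ N) {v : (EuclideanSpace ℝ (Fin 3)) → (EuclideanSpace ℝ (Fin 3))}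
    (hv : AEStronglyMeasurable v (volume.restrict N)) {S : ℝ≥0∞}
    (hS : ∀ i j : Fin 3,
      eLpNorm (fun x => fderiv ℝ (fun y => fderiv ℝ Θ y (EuclideanSpace.basisFun (Fin 3) ℝ i)) x
        (EuclideanSpace.basisFun (Fin 3) ℝ j)) 2 volume ≤ S) :
    ∫⁻ x, ‖fderiv ℝ (fderiv ℝ Θ) x (v x) (v x)‖ₑ ≤
      9 * (∫⁻ x in N, ‖v x‖ₑ ^ (4 : ℕ)) ^ (1 / 2 : ℝ) * S := by
  set e := EuclideanSpace.basisFun (Fin 3) ℝ with he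
  set Hij : Fin 3 → Fin 3 → (EuclideanSpace ℝ (Fin 3)) → ℝ := fun i j x =>
    fderiv ℝ (fun y => fderiv ℝ Θ y (e i)) x (e j) with hHij
  have hHc : ∀ i j, Continuous (Hij i j) := fun i j => by
    have h1 : ContDiff ℝ 1 (fun y => fderiv ℝ Θ y (e i)) :=
      (hΘ2.fderiv_right (m := 1) le_rfl).clm_apply contDiff_const
    exact ((h1.fderiv_right (m := 0) le_rfl).clm_apply contDiff_const).continuous
  have hH0 : ∀ i j x, x ∉ tsupport Θ → Hij i j x = 0 := fun i j x hx =>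
    RRS2016.fderiv2_dir_eq_zero_of_notMem_tsupport hx _ _
  set F : (EuclideanSpace ℝ (Fin 3)) → ℝ := fun x => fderiv ℝ (fderiv ℝ Θ) x (v x) (v x) with hF
  have hFle : ∀ x, ‖F x‖ₑ ≤ ‖v x‖ₑ ^ 2 * ∑ i, ∑ j, ‖Hij i j x‖ₑ := by
    intro x
    have h := abs_fderiv_fderiv_apply_le_norm_sq_mul_sum e hΘ2 x (v x)
    have hdΘ : DifferentiableAt ℝ (fderiv ℝ Θ) x :=
      ((hΘ2.fderiv_right (m := 1) le_rfl).differentiable one_ne_zero) x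
    rw [fderiv_apply_const_apply hdΘ (v x) (v x)] at h
    calc ‖F x‖ₑ = ENNReal.ofReal |F x| := by rw [← Real.norm_eq_abs, ofReal_norm]
      _ ≤ ENNReal.ofReal (‖v x‖ ^ 2 * ∑ i, ∑ j, |Hij i j x|) := ENNReal.ofReal_le_ofReal h
      _ = ‖v x‖ₑ ^ 2 * ∑ i, ∑ j, ‖Hij i j x‖ₑ := by
          rw [ENNReal.ofReal_mul (sq_nonneg _), ENNReal.ofReal_pow (norm_nonneg _), ofReal_norm,
            ENNReal.ofReal_sum_of_nonneg (fun i _ => Finset.sum_nonneg fun j _ => abs_nonneg _)]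
          congr 1
          refine Finset.sum_congr rfl fun i _ => ?_
          rw [ENNReal.ofReal_sum_of_nonneg (fun j _ => abs_nonneg _)]
          refine Finset.sum_congr rfl fun j _ => ?_
          rw [← Real.norm_eq_abs, ofReal_norm]
  have hF0 : ∀ x ∉ N, ‖F x‖ₑ = 0 := by
    intro x hx
    have hxT : x ∉ tsupport Θ := fun h => hx (hsupp h)
    refine le_antisymm ((hFle x).trans (le_of_eq ?_)) zero_le
    simp [hH0 _ _ x hxT]
  have step0 : ∫⁻ x, ‖F x‖ₑ ≤ ∫⁻ x in N, ‖v x‖ₑ ^ 2 * ∑ i, ∑ j, ‖Hij i j x‖ₑ := by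
    calc ∫⁻ x, ‖F x‖ₑ = ∫⁻ x in N, ‖F x‖ₑ := by
          refine (setLIntegral_eq_of_support_subset fun x hx => ?_).symm
          by_contra h
          exact hx (hF0 x h)
      _ ≤ _ := lintegral_mono fun x => hFle x
  have hvN : AEMeasurable (fun x => ‖v x‖ₑ ^ 2) (volume.restrict N) := hv.enorm.pow_const 2
  have hHm : ∀ i j (μ : Measure (EuclideanSpace ℝ (Fin 3))), AEMeasurable (fun x => ‖Hij i j x‖ₑ) μ :=
    fun i j μ => (hHc i j).measurable.enorm.aemeasurable
  have hpq : Real.HolderConjugate 2 2 := Real.holderConjugate_iff.2 ⟨by norm_num, by norm_num⟩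
  have e1 : ∫⁻ x in N, ‖v x‖ₑ ^ 2 * ∑ i, ∑ j, ‖Hij i j x‖ₑ =
      ∑ i, ∑ j, ∫⁻ x in N, ‖v x‖ₑ ^ 2 * ‖Hij i j x‖ₑ := by
    have hgm : ∀ i j, AEMeasurable (fun x => ‖v x‖ₑ ^ 2 * ‖Hij i j x‖ₑ) (volume.restrict N) :=
      fun i j => hvN.mul (hHm i j _)
    simp_rw [Finset.mul_sum]
    rw [lintegral_finsetSum' _ fun i _ => Finset.aemeasurable_fun_sum _ fun j _ => hgm i j]
    exact Finset.sum_congr rfl fun i _ => lintegral_finsetSum' _ fun j _ => hgm i j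
  have e2 : ∀ i j, ∫⁻ x in N, ‖v x‖ₑ ^ 2 * ‖Hij i j x‖ₑ ≤
      (∫⁻ x in N, ‖v x‖ₑ ^ (4 : ℕ)) ^ (1 / 2 : ℝ) * S := by
    intro i j
    have h := ENNReal.lintegral_mul_le_Lp_mul_Lq (volume.restrict N) hpq hvN (hHm i j _)
    simp only [ennreal_sq_rpow_two] at h
    refine h.trans (mul_le_mul' le_rfl ?_)
    have hst := hS i j
    rw [eLpNorm_two_eq'] at hst
    calc (∫⁻ x in N, ‖Hij i j x‖ₑ ^ (2 : ℝ)) ^ (1 / 2 : ℝ)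
        ≤ (∫⁻ x, ‖Hij i j x‖ₑ ^ (2 : ℝ)) ^ (1 / 2 : ℝ) := by
          gcongr; exact Measure.restrict_le_self
      _ ≤ S := hst
  calc ∫⁻ x, ‖F x‖ₑ ≤ _ := step0
    _ = _ := e1
    _ ≤ ∑ _i : Fin 3, ∑ _j : Fin 3, (∫⁻ x in N, ‖v x‖ₑ ^ (4 : ℕ)) ^ (1 / 2 : ℝ) * S :=
        Finset.sum_le_sum fun i _ => Finset.sum_le_sum fun j _ => e2 i j
    _ = 9 * (∫⁻ x in N, ‖v x‖ₑ ^ (4 : ℕ)) ^ (1 / 2 : ℝ) * S := by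
        simp only [Finset.sum_const, Finset.card_univ, Fintype.card_fin, nsmul_eq_mul, Nat.cast_ofNat]
        ring

/-! ## §2 The smoothing term at exponent `2` -/

section Smoothing

variable {r₀ r₁ r : ℝ} {g : (EuclideanSpace ℝ (Fin 3)) → ℝ}

/-- `‖g‖_{L¹} ≤ |B(0,r)|^{1/2} ‖g‖_{L²}` for a test function supported in `B(0, r)` (Cauchy–Schwarz). -/
theorem integral_abs_le_measureReal_rpow_mul_eLpNorm_two (hg : Continuous g)
    (hsupp : tsupport g ⊆ ball (0 : (EuclideanSpace ℝ (Fin 3))) r) :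
    ∫ y, |g y| ≤ (volume.real (ball (0 : (EuclideanSpace ℝ (Fin 3))) r)) ^ (1 / 2 : ℝ) * (eLpNorm g 2 volume).toReal := by
  set B : Set (EuclideanSpace ℝ (Fin 3)) := ball (0 : (EuclideanSpace ℝ (Fin 3))) r with hB
  have hgc : HasCompactSupport g := RRS2016.hasCompactSupport_of_tsupport_subset_ball hsupp
  have hgi : Integrable g := hg.integrable_of_hasCompactSupport hgc
  have hg0 : ∀ x ∉ B, g x = 0 := fun x hx =>
    image_eq_zero_of_notMem_tsupport fun h => hx (hsupp h)
  have hBfin : volume B < ⊤ := measure_ball_lt_top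
  have e1 : ENNReal.ofReal (∫ y, |g y|) = eLpNorm g 1 (volume.restrict B) := by
    rw [eLpNorm_one_eq_lintegral_enorm, ← setIntegral_eq_integral_of_forall_compl_eq_zero
      (fun x hx => by rw [hg0 x hx, abs_zero]),
      ofReal_integral_eq_lintegral_ofReal hgi.abs.integrableOn (ae_of_all _ fun y => abs_nonneg _)]
    refine lintegral_congr fun y => ?_
    rw [← Real.norm_eq_abs, ofReal_norm]
  have e2 : eLpNorm g 1 (volume.restrict B) ≤
      eLpNorm g 2 volume * (volume B) ^ (1 / 2 : ℝ) := by
    have h := eLpNorm_le_eLpNorm_mul_rpow_measure_univ (p := 1) (q := 2) (by norm_num)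
      (hg.aestronglyMeasurable (μ := volume.restrict B))
    rw [Measure.restrict_apply_univ, ENNReal.toReal_one,
      show (1 : ℝ) / 1 - 1 / (2 : ℝ≥0∞).toReal = 1 / 2 by norm_num] at h
    refine h.trans (mul_le_mul' (eLpNorm_mono_measure g Measure.restrict_le_self) le_rfl)
  have hfin3 : eLpNorm g 2 volume < ⊤ := (hg.memLp_of_hasCompactSupport hgc).eLpNorm_lt_top
  have hfinr : (volume B) ^ (1 / 2 : ℝ) ≠ ⊤ :=
    ENNReal.rpow_ne_top_of_nonneg (by norm_num) hBfin.ne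
  have h3 : ENNReal.ofReal (∫ y, |g y|) ≤ eLpNorm g 2 volume * (volume B) ^ (1 / 2 : ℝ) := by
    rw [e1]; exact e2
  have h4 := (ENNReal.ofReal_le_iff_le_toReal (ENNReal.mul_ne_top hfin3.ne hfinr)).1 h3
  rw [ENNReal.toReal_mul, ← ENNReal.toReal_rpow, mul_comm] at h4
  exact h4

/-- **The smoothing term of the dual pressure estimate at exponent `2`.**  For radii `0 < r < r₀ < r₁` there is
`C = C(r₀, r₁, r) ≥ 0` with `|∫ π Λ^{r₀,r₁}[g]| ≤ C_p C ‖g‖_{L²}` for every `π` with `|π| ≤ C_p` on the shell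
`r₀ − r < |x| < r₁ + r` and every test function `g` supported in `B(0, r)`. -/
theorem exists_abs_integral_mul_newtonFarSmoothing_le_two (h₀ : 0 < r₀) (h₁ : r₀ < r₁) (r : ℝ) :
    ∃ C : ℝ, 0 ≤ C ∧ ∀ (π : (EuclideanSpace ℝ (Fin 3)) → ℝ) (Cp : ℝ), 0 ≤ Cp →
      (∀ x : (EuclideanSpace ℝ (Fin 3)), r₀ - r < ‖x‖ → ‖x‖ < r₁ + r → |π x| ≤ Cp) →
      ∀ g : (EuclideanSpace ℝ (Fin 3)) → ℝ, Continuous g → tsupport g ⊆ ball (0 : (EuclideanSpace ℝ (Fin 3))) r →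
        |∫ x, π x * newtonFarSmoothing r₀ r₁ g x| ≤ Cp * C * (eLpNorm g 2 volume).toReal := by
  obtain ⟨M, hM⟩ := (continuous_newtonFarLaplacian h₀ h₁).bounded_above_of_compact_support
    (hasCompactSupport_newtonFarLaplacian h₀.le h₁)
  have hM0 : 0 ≤ M := (norm_nonneg _).trans (hM 0)
  set Sh : Set (EuclideanSpace ℝ (Fin 3)) := {x | r₀ - r < ‖x‖ ∧ ‖x‖ < r₁ + r} with hSh
  have hShsub : Sh ⊆ ball (0 : (EuclideanSpace ℝ (Fin 3))) (r₁ + r) := fun x hx => mem_ball_zero_iff.2 hx.2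
  have hShfin : volume Sh < ⊤ := lt_of_le_of_lt (measure_mono hShsub) measure_ball_lt_top
  set V : ℝ := (volume.real (ball (0 : (EuclideanSpace ℝ (Fin 3))) r)) ^ (1 / 2 : ℝ) with hV
  have hV0 : 0 ≤ V := Real.rpow_nonneg measureReal_nonneg _
  refine ⟨M * V * volume.real Sh, by positivity, fun π Cp hCp hπ g hg hsupp => ?_⟩
  have hgc : HasCompactSupport g := RRS2016.hasCompactSupport_of_tsupport_subset_ball hsupp
  have hΛ0 : ∀ x ∉ Sh, newtonFarSmoothing r₀ r₁ g x = 0 := by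
    intro x hx
    refine newtonFarSmoothing_eq_zero_of_notMem_shell h₀.le h₁ hsupp ?_
    by_contra h
    rw [not_or, not_le, not_le] at h
    exact hx ⟨h.1, h.2⟩
  have hΛb : ∀ x, |newtonFarSmoothing r₀ r₁ g x| ≤ M * ∫ y, |g y| := fun x =>
    abs_newtonFarSmoothing_le_of_forall_abs_le (fun z => (Real.norm_eq_abs _).symm.le.trans (hM z))
      hg hgc x
  have hL1 := integral_abs_le_measureReal_rpow_mul_eLpNorm_two hg hsupp
  have hI0 : 0 ≤ ∫ y, |g y| := integral_nonneg fun y => abs_nonneg _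
  have e1 : ∫ x, π x * newtonFarSmoothing r₀ r₁ g x = ∫ x in Sh, π x * newtonFarSmoothing r₀ r₁ g x :=
    (setIntegral_eq_integral_of_forall_compl_eq_zero fun x hx => by rw [hΛ0 x hx, mul_zero]).symm
  have e2 : ‖∫ x in Sh, π x * newtonFarSmoothing r₀ r₁ g x‖ ≤
      Cp * (M * (V * (eLpNorm g 2 volume).toReal)) * volume.real Sh := by
    refine norm_setIntegral_le_of_norm_le_const hShfin fun x hx => ?_
    rw [norm_mul, Real.norm_eq_abs, Real.norm_eq_abs]
    refine mul_le_mul (hπ x hx.1 hx.2) ((hΛb x).trans ?_) (abs_nonneg _) hCp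
    exact mul_le_mul_of_nonneg_left hL1 hM0
  rw [← Real.norm_eq_abs, e1]
  refine e2.trans (le_of_eq ?_)
  ring

end Smoothing

/-! ## §3 The dual estimate and duality at exponent `2` -/

section Dual

-- nested operator types
set_option maxSynthPendingDepth 3

variable {r₀ r₁ r R : ℝ}

/-- **The dual pressure estimate with a bounded far field, exponent `2`.**  With `π ∈ L¹(B(0,R))`, the weak slice pressure
equation `∫ π Δψ = -∫ D²ψ(v, v)` for test functions supported in `B(0,R)`, `|π| ≤ C_p` on the shell `r₀ − r < |x| < r₁ + r`
(`r + r₁ < R`): for every test function `g` supported in `B(0,r)`, `|∫ π g| ≤ (9 A ‖v‖²_{L⁴(B_R)} + C_p C_Λ) ‖g‖_{L²}`. -/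
theorem abs_integral_mul_test_le_of_slice_identity_two {A : ℝ≥0}
    (hA : ∀ ⦃g : (EuclideanSpace ℝ (Fin 3)) → ℝ⦄, ContDiff ℝ 2 g → HasCompactSupport g → ∀ a b : (EuclideanSpace ℝ (Fin 3)), ‖a‖ ≤ 1 → ‖b‖ ≤ 1 →
      eLpNorm (fun x => fderiv ℝ (fun y => fderiv ℝ (newtonNearPotential r₀ r₁ g) y a) x b) 2
        volume ≤ A * eLpNorm g 2 volume)
    {CΛ : ℝ} (hCΛ : ∀ (π : (EuclideanSpace ℝ (Fin 3)) → ℝ) (Cp : ℝ), 0 ≤ Cp →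
      (∀ x : (EuclideanSpace ℝ (Fin 3)), r₀ - r < ‖x‖ → ‖x‖ < r₁ + r → |π x| ≤ Cp) →
      ∀ g : (EuclideanSpace ℝ (Fin 3)) → ℝ, Continuous g → tsupport g ⊆ ball (0 : (EuclideanSpace ℝ (Fin 3))) r →
        |∫ x, π x * newtonFarSmoothing r₀ r₁ g x| ≤ Cp * CΛ * (eLpNorm g 2 volume).toReal)
    (h₀ : 0 < r₀) (h₁ : r₀ < r₁) (hR : r + r₁ < R)
    {v : (EuclideanSpace ℝ (Fin 3)) → (EuclideanSpace ℝ (Fin 3))} {π : (EuclideanSpace ℝ (Fin 3)) → ℝ} (hv : AEStronglyMeasurable v (volume.restrict (ball (0 : (EuclideanSpace ℝ (Fin 3))) R)))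
    (hX : ∫⁻ x in ball (0 : (EuclideanSpace ℝ (Fin 3))) R, ‖v x‖ₑ ^ (4 : ℕ) ≠ ⊤)
    (hπ : IntegrableOn π (ball (0 : (EuclideanSpace ℝ (Fin 3))) R) volume)
    {Cp : ℝ} (hCp : 0 ≤ Cp) (hπb : ∀ x : (EuclideanSpace ℝ (Fin 3)), r₀ - r < ‖x‖ → ‖x‖ < r₁ + r → |π x| ≤ Cp)
    (hid : ∀ ψ : (EuclideanSpace ℝ (Fin 3)) → ℝ, ContDiff ℝ (⊤ : ℕ∞) ψ → HasCompactSupport ψ →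
      tsupport ψ ⊆ ball (0 : (EuclideanSpace ℝ (Fin 3))) R →
        ∫ x, π x * Δ ψ x = -∫ x, fderiv ℝ (fderiv ℝ ψ) x (v x) (v x))
    {g : (EuclideanSpace ℝ (Fin 3)) → ℝ} (hg : ContDiff ℝ (⊤ : ℕ∞) g) (hsupp : tsupport g ⊆ ball (0 : (EuclideanSpace ℝ (Fin 3))) r) :
    |∫ x, π x * g x| ≤
      (9 * A * ((∫⁻ x in ball (0 : (EuclideanSpace ℝ (Fin 3))) R, ‖v x‖ₑ ^ (4 : ℕ)) ^ (1 / 2 : ℝ)).toReal + Cp * CΛ) *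
        (eLpNorm g 2 volume).toReal := by
  have hr₁ : 0 < r₁ := h₀.trans h₁
  set Θ := newtonNearPotential r₀ r₁ g with hΘ_def
  set Λ := newtonFarSmoothing r₀ r₁ g with hΛ_def
  have hg2 : ContDiff ℝ 2 g := contDiff_infty.1 hg 2
  have hgc : HasCompactSupport g := RRS2016.hasCompactSupport_of_tsupport_subset_ball hsupp
  have hΘs : ContDiff ℝ (⊤ : ℕ∞) Θ := contDiff_newtonNearPotential_top h₀.le h₁ hg
  have hΘ2 : ContDiff ℝ 2 Θ := contDiff_infty.1 hΘs 2
  have hΘc : HasCompactSupport Θ := hasCompactSupport_newtonNearPotential h₀.le h₁ hgc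
  have hΘsupp : tsupport Θ ⊆ closedBall (0 : (EuclideanSpace ℝ (Fin 3))) (r + r₁) := by
    refine closure_minimal (fun x hx => ?_) isClosed_closedBall
    rw [mem_closedBall, dist_zero_right]
    by_contra h
    refine hx (RRS2016.newtonNearPotential_eq_zero_of_far h₀.le h₁ hsupp ?_)
    rw [sub_zero]
    exact (not_le.1 h).le
  have hΘball : tsupport Θ ⊆ ball (0 : (EuclideanSpace ℝ (Fin 3))) R := hΘsupp.trans (closedBall_subset_ball hR)
  have hΛc : Continuous Λ := continuous_newtonFarSmoothing h₀ h₁ hg.continuous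
  have hΛ0 : ∀ x ∉ closedBall (0 : (EuclideanSpace ℝ (Fin 3))) (r + r₁), Λ x = 0 := fun x hx => by
    rw [mem_closedBall, dist_zero_right, not_le] at hx
    exact newtonFarSmoothing_eq_zero_of_notMem_shell h₀.le h₁ hsupp (Or.inr (by linarith))
  have hg0 : ∀ x ∉ closedBall (0 : (EuclideanSpace ℝ (Fin 3))) (r + r₁), g x = 0 := fun x hx =>
    image_eq_zero_of_notMem_tsupport fun h => hx
      ((hsupp.trans (ball_subset_closedBall.trans (closedBall_subset_closedBall (by linarith)))) h)
  have hπK : IntegrableOn π (closedBall (0 : (EuclideanSpace ℝ (Fin 3))) (r + r₁)) volume :=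
    hπ.mono_set (closedBall_subset_ball hR)
  have hIg : Integrable (fun x => π x * g x) :=
    (integrable_mul_of_eq_zero_off_compact (isCompact_closedBall (0 : (EuclideanSpace ℝ (Fin 3))) (r + r₁)) hg.continuous
      hg0 hπK).congr (Eventually.of_forall fun x => mul_comm _ _)
  have hIΛ : Integrable (fun x => π x * Λ x) :=
    (integrable_mul_of_eq_zero_off_compact (isCompact_closedBall (0 : (EuclideanSpace ℝ (Fin 3))) (r + r₁)) hΛc hΛ0
      hπK).congr (Eventually.of_forall fun x => mul_comm _ _)
  have htest := hid Θ hΘs hΘc hΘball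
  have hΔ : ∀ x, Δ Θ x = g x - Λ x := fun x => laplacian_newtonNearPotential h₀ h₁ hg2 x
  have hsplit : ∫ x, π x * g x = (∫ x, π x * Δ Θ x) + ∫ x, π x * Λ x := by
    have e : (fun x => π x * Δ Θ x) = fun x => π x * g x - π x * Λ x := by
      funext x; rw [hΔ x]; ring
    rw [e, integral_sub hIg hIΛ, sub_add_cancel]
  set X : ℝ≥0∞ := ∫⁻ x in ball (0 : (EuclideanSpace ℝ (Fin 3))) R, ‖v x‖ₑ ^ (4 : ℕ) with hX_def
  have hS : ∀ i j : Fin 3,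
      eLpNorm (fun x => fderiv ℝ (fun y => fderiv ℝ Θ y (EuclideanSpace.basisFun (Fin 3) ℝ i)) x
        (EuclideanSpace.basisFun (Fin 3) ℝ j)) 2 volume ≤ A * eLpNorm g 2 volume := by
    intro i j
    have hi : ‖EuclideanSpace.basisFun (Fin 3) ℝ i‖ ≤ 1 :=
      ((EuclideanSpace.basisFun (Fin 3) ℝ).orthonormal.1 i).le
    have hj : ‖EuclideanSpace.basisFun (Fin 3) ℝ j‖ ≤ 1 :=
      ((EuclideanSpace.basisFun (Fin 3) ℝ).orthonormal.1 j).le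
    exact hA hg2 hgc _ _ hi hj
  have hH := lintegral_enorm_hessian_apply_le_sq hΘ2 hΘball hv hS
  have hg3 : eLpNorm g 2 volume < ⊤ :=
    (hg.continuous.memLp_of_hasCompactSupport hgc).eLpNorm_lt_top
  have hX23 : X ^ (1 / 2 : ℝ) ≠ ⊤ := ENNReal.rpow_ne_top_of_nonneg (by norm_num) hX
  have hRHS : 9 * X ^ (1 / 2 : ℝ) * (A * eLpNorm g 2 volume) ≠ ⊤ :=
    ENNReal.mul_ne_top (ENNReal.mul_ne_top (by norm_num) hX23)
      (ENNReal.mul_ne_top ENNReal.coe_ne_top hg3.ne)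
  have hHreal : |∫ x, fderiv ℝ (fderiv ℝ Θ) x (v x) (v x)| ≤
      9 * A * (X ^ (1 / 2 : ℝ)).toReal * (eLpNorm g 2 volume).toReal := by
    have h1 : ENNReal.ofReal |∫ x, fderiv ℝ (fderiv ℝ Θ) x (v x) (v x)| ≤
        9 * X ^ (1 / 2 : ℝ) * (A * eLpNorm g 2 volume) := by
      refine le_trans ?_ hH
      rw [← Real.enorm_eq_ofReal_abs]
      exact enorm_integral_le_lintegral_enorm _
    have h2 := (ENNReal.ofReal_le_iff_le_toReal hRHS).1 h1
    refine h2.trans (le_of_eq ?_)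
    rw [ENNReal.toReal_mul, ENNReal.toReal_mul, ENNReal.toReal_mul, ENNReal.coe_toReal]
    norm_num
    ring
  have hΛreal : |∫ x, π x * Λ x| ≤ Cp * CΛ * (eLpNorm g 2 volume).toReal :=
    hCΛ π Cp hCp hπb g hg.continuous hsupp
  rw [hsplit, htest]
  calc |-(∫ x, fderiv ℝ (fderiv ℝ Θ) x (v x) (v x)) + ∫ x, π x * Λ x|
      ≤ |-(∫ x, fderiv ℝ (fderiv ℝ Θ) x (v x) (v x))| + |∫ x, π x * Λ x| := abs_add_le _ _
    _ = |∫ x, fderiv ℝ (fderiv ℝ Θ) x (v x) (v x)| + |∫ x, π x * Λ x| := by rw [abs_neg]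
    _ ≤ 9 * A * (X ^ (1 / 2 : ℝ)).toReal * (eLpNorm g 2 volume).toReal +
          Cp * CΛ * (eLpNorm g 2 volume).toReal := add_le_add hHreal hΛreal
    _ = _ := by ring

/-- **Duality at exponent `2`**: `|∫ π g| ≤ K ‖g‖_{L²}` for all test functions supported in `B(0,r)`, `π ∈ L¹(B(0,r))`, gives
`∫_{B(0,r)} |π|² ≤ K²`. -/
theorem lintegral_ball_enorm_sq_le_of_forall_test {π : (EuclideanSpace ℝ (Fin 3)) → ℝ} {K : ℝ}
    (hK : 0 ≤ K) (hπ : IntegrableOn π (ball (0 : (EuclideanSpace ℝ (Fin 3))) r) volume)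
    (h : ∀ g : (EuclideanSpace ℝ (Fin 3)) → ℝ, ContDiff ℝ (⊤ : ℕ∞) g → HasCompactSupport g →
      tsupport g ⊆ ball (0 : (EuclideanSpace ℝ (Fin 3))) r → |∫ x, π x * g x| ≤ K * (eLpNorm g 2 volume).toReal) :
    ∫⁻ x in ball (0 : (EuclideanSpace ℝ (Fin 3))) r, ‖π x‖ₑ ^ (2 : ℝ) ≤ ENNReal.ofReal (K ^ (2 : ℝ)) := by
  have hpq : (2 : ℝ).HolderConjugate 2 := Real.holderConjugate_iff.2 ⟨by norm_num, by norm_num⟩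
  refine FunctionSpaces.lintegral_rpow_enorm_le_of_forall_test isOpen_ball hπ hpq hK
    fun Ψ hΨ hΨc hΨs => ?_
  have e1 : ∫ x in ball (0 : (EuclideanSpace ℝ (Fin 3))) r, π x * Ψ x = ∫ x, π x * Ψ x :=
    setIntegral_eq_integral_of_forall_compl_eq_zero fun x hx => by
      rw [image_eq_zero_of_notMem_tsupport fun h' => hx (hΨs h'), mul_zero]
  have e3 : ENNReal.ofReal 2 = (2 : ℝ≥0∞) := by norm_num
  rw [e1, e3]
  exact h Ψ hΨ hΨc hΨs

end Dual

end Summit.NavierStokesRegularity.NavierStokesRegularity.Theorems.ScalingDefectPeepholeDoor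

end
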